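import Summits.QuantumFields.YangMills.Theorems.BalabanUVNodesN07HalvingStepTopCoreOfLocalLetters
import Literature.MathematicalPhysics.QuantumFieldTheory.Balaban1983to89.Node00.TorusCoverCoreLevel
import Literature.MathematicalPhysics.QuantumFieldTheory.Balaban1983to89.Node00.TorusCoverBoxStencilsPrint

/-!
# BalabanUVNodes ∕ N07 — [15] SECT. F, THE HEAD OF THE ONE-STEP IMPROVEMENT AT THE OBJECTS OF RECORD, GEOMETRIC HALF: the per-plaquette ∕ per-bond local-gauge
# token `LocalLetters165TopStepCore` (p587134) REDUCED to ONE sentence indexed by the DATA CUBES of door (a) — «a (165)-shaped local gauge on the window `π(□)` of the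
# print datum of every level-`j` grid cube near `Ω_j`» —, the level, the cube and the window stencil WITNESSED BY NAME

Cell `pub-ymgap`, width seat `pub-ymgap-dag-n07-w4` gen 3 (director-ym №197 ∕ HUMAN RULING D-0149), node N07 = [15] = T. Bałaban, *The variational problem and background
fields in renormalization group method for lattice gauge theories*, Commun. Math. Phys. **102** (1985) 277–309 [Balaban1985Variational]; [6] = [Balaban1985RegularSpaces];
sub-target S6 of plan's `W-SEAT-START-LIST.md` § n07 (the HEAD knit of the (165)-letters), CLAIM-1 ∕ INTENT-1 of 2026-08-28 (bus I.30016).  NEW Theorems-side leaf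
(`--supports stmt-QuantumFields-20542 --as helper`; ONE displayed `def … : Prop` token, NEVER asserted, + theorems); CONSUMED BY NAME, nothing modified: this seat's p587134
`…N07HalvingStepTopCoreOfLocalLetters` (`LocalLetters165TopStepCore`, `halvingStepTopCore_of_localLetters165Core`), p584895 `…N07HalvingStepTopOfLocalLetters` (`Letters10On`),
p594564 `Node00.TorusCoverCoreLevel` (`Sect2.exists_level_of_core_plaq ∕ _bond`), p606159 `Node00.TorusCoverBoxStencilsPrint` (`Sect2.mem_plaqInside_cover_box_propCubeP`,
`Sect2.mem_bondsDeep_cover_box_propCubeP`), n07-e's 36a `Node00.TorusCoverCubeMemberPrint` (`propCubeP`, `cornerP`, `sideP`), 33b's `Sect2.LocalGauge10On ∕ Sect2.bondsDeep`,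
k0-s1-w3's `HalvingStepTopCore`, def-P11's `Sect2.omegaPlaqsTop ∕ omegaBondsTop ∕ printedPlaqs`, lit's `B14DomainGeom.Within ∕ cubeIdx`, `B14.Eq213MaximalDomains.side ∕ cubeExt`,
`B15Eq112TorusCover.cover ∕ lift`, n05-a's `B8Eq131Cubes.box`.  COUNT-NEUTRAL.

WHY.  Print p. 302 fixes, for each plaquette `p` (or bond `b`) of the class, ONE unit cube and ONE big cube: *«for a plaquette p, or a bond b, we take a unit cube
Δ₀ ⊂ B_j(Λ_j) containing p or b.  The cube Δ₀ is contained in a big cube … and we take □ as this big cube»*, runs the whole chain (144)–(167) on `□` (the gauge (152), the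
equation (158), the combination (159), the letters (160)–(165)), and closes on p. 304: *«we conclude that U′_k satisfies (2) on Δ₀ with max{B₃ε₁, ½ε₀} instead of ε₀.  The
cube Δ₀ is an arbitrary cube Δ(y) = B^j(y), if y ∈ Λ_j, hence U_k belongs to the space (2) with max{B₃ε₁, ½ε₀} instead of ε₀»*.  The S6 tokens of p584895 ∕ p587134 ask the
chain's OUTPUT per plaquette ∕ per bond in the form `∃ Y ∃ i, m ≤ i ≤ k ∧ p ∈ plaqInside Y ∧ Sect2.LocalGauge10On Y η_i (C·δ_i + θ·ε_i + Q·ε_i²) U` (n07-e g14: «the ∃-Y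
∃-level form IS the right cut»).  The chain itself, however, is indexed by BIG CUBES, not by plaquettes: one gauge `u` and one potential `A` per `□` serve every plaquette and
bond whose unit cube lies in `□`.  At door (a) OF RECORD (n07-e LOCATED-TOWER, INBOX l.27663; this seat g2 l.27845) the big cube of a plaquette of level `j` is the box
`□ = box L (cornerP Mc ρ a) (sideP Mc ρ) j` of the PRINT datum `propCubeP j Mc ρ a` (36a: corner on the `ρ`-grid below `Mc·a`, side a multiple of `ρ` above
`Mc + 11d + ρ`) of the grid cube `a = cubeIdx (LʲMc) (lift p₋)` of its base corner (for a bond: of `lift b₋ − 𝟙`, so that the whole (1.9)-stencil fits), and the three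
geometric facts the ∃-introduction needs are ALREADY in the tree, by name: the LEVEL `j`, `max m 1 ≤ j ≤ k`, at which a core plaquette of the level-`m` clause meets `Ω_j`
(p594564 `Sect2.exists_level_of_core_plaq`; for a core bond, at which its stencil meets `Ω_j`, `Sect2.exists_level_of_core_bond`); the WINDOW STENCIL `p ∈ plaqInside π(□)`
∕ `b ∈ Sect2.bondsDeep π(□)` (p606159); and the `Within 3` WITNESS of a site of `Ω_j` next to the grid cube (the currency of p592904's (144) collar
`Sect2.cover_image_tcube_subset_of_within_mem`, which is what the SUPPLIER of the gauge consumes at that cube).  THIS FILE performs that ∃-introduction once and for all: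
the per-plaquette token REDUCES to ONE per-datum sentence (§1's `DatumGauge165TopStepCore`) — «for every level `1 ≤ j ≤ k` and every grid index `a` whose level-`j`
`Mc`-cube has a point within `3` of a lift of a site of `Ω_j`, `U` carries a local gauge on `π(□(j, a))` at the unit `η_j` with the three letters below
`C·δ_j + θ·ε_j + Q·ε_j²`» —, which is exactly the sentence the supply rows deliver into (S3's gauge (152)∕(157) on `□`, the (159) decomposition, and the summand letters:
`HB` by this seat's g2 `letters10On_HB_cubeDomains_box(_of_centred)` at the same window, `A₁` by piece 4 (n07-w8 p608198) through `letters10On_of_realRows_hodge` (p607289),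
`H_V𝔇(A′)` by `letters10On_H_uniform_cubeDomains_box`, the pure-gauge row (r2) under road R0′; assembled by p584895's `localGauge10On_of_eq159`).  The reduction is
ROAD-INDEPENDENT (R0′ ∕ R4 differ only in how the per-datum gauge is produced) and leaves print's `M`, `ρ` FREE (`Mc ρ : ℕ`, the supplier's choice: (1.130)–(1.131)).

CONTENTS.  §1 ★★ `DatumGauge165TopStepCore F N Sup Mc ρ B₃ C θ Q a₀ a₁` (def `Prop`, NEVER asserted: the binder block of `HalvingStepTop` ∕ `LocalLetters165TopStepCore`
BYTE FOR BYTE; conclusion = the per-datum sentence), `.of_le` (antitone in the ceilings), `.of_le_budget` (monotone in `C θ Q`).  §2 plumbing (the grid cube of a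
lift, the `Within 3` witnesses of a plaquette MEETING a set ∕ of a bond whose stencil meets it — the private lemmas of p592904 ∕ p594564 re-derived PUBLICLY here, for reuse by
the R0′ split edition of this interface).  §3 ★★★ `localLetters165Core_of_datumGauge165Core : 1 ≤ Mc → F.L ≤ ρ → DatumGauge165TopStepCore … → LocalLetters165TopStepCore F N Sup B₃ C θ Q a₀ a₁`,
★★ `halvingStepTopCore_of_datumGauge165Core` (∘ p587134: `… → HalvingStepTopCore F N Sup B₃ a₀ a₁` under print's (162)∕(163)∕(166) smallness in the tree's constants).
§4 door algebra (generic, for the assembly of ANY number of (159)-summands at the window): `Letters10On.add`, `Letters10On.sub`.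

READINGS displayed (unchanged from p584895 ∕ p587134 ∕ module 30): criticality in the CURVE form (`IsCritOnFibre`; GAP-STATED(submersion)); LEVEL-DEPENDENT radii (module 30,
LOCATED); the CORE restriction (k0-s1-w3); door (a)'s window = `π '' box` of the PRINT datum (36a), collar `ρ`, side `sideP ≥ Mc + 11d + ρ + 1`; the `Within 3` meeting
condition (radius `3` = the farthest stencil point `x + 2e_μ` of a bond from `x − 𝟙`; a plaquette's corners are within `1`).
WHAT IS NOT HERE (honest scope): the per-datum sentence is NOT discharged — its discharge IS the Sect. F chain on `□` (sub-targets S3–S5, rows (r0)–(r3) of road R0′, piece 1b,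
piece 4), none of which is this seat's; nothing of (144)–(167) is proved; `LocalLetters165TopStepCore` ∕ `HalvingStepTopCore` ∕ `HalvingStepTop` are concluded FROM the new token,
not discharged (A6: LOCATED — antecedent = the token; its binder block is inhabited by n07-e's `…N07Prop8StepFlatWitness.halvingStepTop_binders_inhabited_flat`).

HONEST FRAMING: one displayed `Prop` (never asserted) + kernel bookkeeping (∃-introductions from named tree lemmas, integer box arithmetic, two triangle inequalities);
NOTHING of Bałaban's analysis is proved; `stub_prop8StepCoP13` ∕ K0⁷ ∕ K1⁷ NOT closed; N07 NOT discharged; counts unmoved (28∕28 · 5∕27); one finite 𝕋⁴ programme at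
fixed ε — R4 closes the conditional finite-𝕋⁴ rung `BalabanLadder.UV` ONLY, never the summit; the YM mass gap (Clay) is NOT proved by any of this; nothing continuum ∕ ℝ⁴ ∕
OS.  One `def`, no `instance` ∕ `notation` ∕ `sorry`.
-/

noncomputable section

namespace Summit.QuantumFields.YangMills.BalabanUVNodes.N07LocalLettersCoreOfDatumGauges

open scoped Matrix.Norms.L2Operator
open Literature.MathematicalPhysics.QuantumFieldTheory.Balaban1983to89
open Literature.MathematicalPhysics.QuantumFieldTheory.Balaban1983to89.Node00
open Literature.MathematicalPhysics.QuantumFieldTheory.Balaban1983to89.T4Continuum (T4Family)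
open Literature.MathematicalPhysics.QuantumFieldTheory.Balaban1983to89.B15DeterminingSets
open Literature.MathematicalPhysics.QuantumFieldTheory.Balaban1983to89.B12RegularSpaces111 (grad)
open B15Eq112TorusCover (cover lift cover_lift)
open B14DomainGeom (Pt Within cubeIdx cubeIdx_le lt_cubeIdx)
open B14.Eq213MaximalDomains (side cubeExt)
open B7Prop1Explicit (e e_apply)
open B8Eq131Cubes (box)
open Summit.QuantumFields.YangMills.BalabanUVNodes.N07HalvingStepTopOfLocalLetters
open Summit.QuantumFields.YangMills.BalabanUVNodes.N07HalvingStepTopCoreOfLocalLetters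

/-! ## §1  ★★ The per-datum token: a (165)-shaped local gauge on the window of the print datum of every grid cube near `Ω_j` -/

section Token

variable (F : T4Family) (N : ℕ) [NeZero N]

/-- ★★ **[15] (165) IN THE GAUGE OF THE BIG CUBE `□`, PER DATA CUBE, AT THE OBJECTS OF RECORD — TOKEN FORM** (the sentence the Sect. F chain (144)–(165) delivers on ONE big
cube, before the per-plaquette reading of p. 304).  Binder block = n07-e's `HalvingStepTop F N Sup B₃ a₀ a₁` ∕ this seat's `LocalLetters165TopStepCore` BYTE FOR BYTE (separated
(2.18) index `s` with `0 < ν.M₁`, `1 ≤ k`; data thresholds `0 < δ_n ≤ a₁` and class radii `B₃δ_n ≤ ε_n ≤ a₀`, both 2-comparable both ways; a (7)-regular datum `W`; a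
configuration `U` in the class (6) on `Ω₀ = Sup ν K s.Ω`, on the fibre of `W`, critical there).  CONCLUSION: for every level `j`, `1 ≤ j ≤ k`, and every grid index
`a ∈ ℤᵈ` such that the level-`j` grid cube of side `LʲMc` and index `a` (lit's `cubeExt (side L Mc j) a 0`) has a point `x` within sup-distance `3` of a lift `y` of a site
of `Ω_j` (print's «Δ₀ ⊂ B_j(Λ_j)»: the cube MEETS the level-`j` region, in the `Within` currency of the (144) collar lemma `Sect2.cover_image_tcube_subset_of_within_mem`),
the configuration `U` carries 33b's local gauge `Sect2.LocalGauge10On Y η_j (C·δ_j + θ·ε_j + Q·ε_j²) U` (`(ι∘U)^{ι∘u} = e^{iη_jA}` on the bonds of `Y`, `‖A‖, ‖∇^{η_j}A‖ <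
t` there, `‖∂^{η_j*}∂^{η_j}A‖ < t` on the deep bonds) on the WINDOW `Y = π(□)`, `□ = box L (cornerP Mc ρ a) (sideP Mc ρ) j` the box of the print datum `propCubeP j Mc ρ a`
(36a) — print's (165) «|A|, |∇^ηA|, |∂^{η*}∂^ηA|, |Δ^ηA| < ¼M_Δmax{B₃ε₁, ½ε₀} + B₀C₄(…)² + B₀4C₂(…)² on □» read with the budget letters `C`, `θ`, `Q` of
`LocalLetters165TopStep` (p584895 §3).  `Mc`, `ρ` are print's `M` and collar width, FREE here (the supplier's (1.130)–(1.131)).  A `Prop`, NEVER asserted; its discharge is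
the Sect. F chain on `□` (S3's gauge, (159), the summand letters).
-- TODO(general form): ONE threshold ε₁ and ONE radius ε₀ in print; general admissible `{Ω_j}` ∕ `𝔅_k` of [6] Sect. A; print's (82) tangent criticality; print's (165)
-- carries also the Laplacian member `|Δ^ηA|`, not needed for (8).
[cite: Balaban1985Variational, (165) p.304, p.302 («a unit cube Δ₀ ⊂ B_j(Λ_j) containing p or b … we take □ as this big cube»), (144) p.300, Sect. F pp.300–304, (2)–(8) pp.278–279; Balaban1985RegularSpaces, (1.7)–(1.9) p.77, (1.130)–(1.131) p.99; Balaban1988Convergent, (2.12)–(2.13) p.256] -/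
def DatumGauge165TopStepCore (Sup : (ν : Stage7Numerics) → (K : ℕ) → (ℕ → Set (Site (F.P K) 0)) → Set (Site (F.P K) 0)) (Mc ρ : ℕ)
    (B₃ C θ Q a₀ a₁ : ℝ) : Prop :=
  ∀ (ν : Stage7Numerics) (M : ℕ) (g : ℕ → ℝ) (K k : ℕ) (s : SeqOfRecord F ν M g K k), Sect2.SeqSeparated ν.M₁ s → 0 < ν.M₁ → 1 ≤ k →
    ∀ (ε δ : ℕ → ℝ),
    (∀ n, n ≤ k → 0 < δ n ∧ δ n ≤ a₁) → (∀ n, n < k → δ n ≤ 2 * δ (n + 1)) → (∀ n, n < k → δ (n + 1) ≤ 2 * δ n) →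
    (∀ n, n ≤ k → B₃ * δ n ≤ ε n ∧ ε n ≤ a₀) → (∀ n, n < k → ε n ≤ 2 * ε (n + 1)) → (∀ n, n < k → ε (n + 1) ≤ 2 * ε n) →
    ∀ W : MSField (F.P K) (SU N), Sect2.DataSmall7PTop (avOfRecord F N K) s.Ω (Sup ν K s.Ω) k δ W →
      ∀ U : GaugeField (F.P K) 0 (SU N),
        (∀ n, n ≤ k → PlaqSmallOn (Sect2.omegaPlaqsTop s.Ω (Sup ν K s.Ω) n) (ε n * (F.P K).eta n ^ 2) U) →
        (∀ n, n ≤ k → Sect2.CoDivSmallOn (Sect2.omegaBondsTop s.Ω (Sup ν K s.Ω) n) (ε n * (F.P K).eta n ^ 3) U) →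
        AgreeOn (genSet s.Ω k) (avgFamily (avOfRecord F N K) U) W →
        IsCritOnFibre F N K (genSet s.Ω k) W U →
        ∀ j, 1 ≤ j → j ≤ k → ∀ a : Pt (F.P K).d,
          (∃ x y : Pt (F.P K).d, x ∈ cubeExt (side (F.P K).L Mc j) a 0 ∧ cover (F.P K) y ∈ s.Ω j ∧ Within ((3 : ℕ) : ℤ) x y) →
          Sect2.LocalGauge10On (cover (F.P K) '' box (F.P K).L (cornerP (F.P K) Mc ρ a) (sideP (F.P K) Mc ρ) j)
            ((F.P K).eta j) (C * δ j + θ * ε j + Q * ε j ^ 2) U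

variable {F N}

/-- The per-datum token is ANTITONE in the ceilings `a₀`, `a₁` (its conclusion does not read them). [cite: Balaban1985Variational, (165)–(166) p.304 (bookkeeping)] -/
theorem DatumGauge165TopStepCore.of_le {Sup : (ν : Stage7Numerics) → (K : ℕ) → (ℕ → Set (Site (F.P K) 0)) → Set (Site (F.P K) 0)} {Mc ρ : ℕ}
    {B₃ C θ Q a₀ a₀' a₁ a₁' : ℝ} (h : DatumGauge165TopStepCore F N Sup Mc ρ B₃ C θ Q a₀ a₁) (ha₀ : a₀' ≤ a₀) (ha₁ : a₁' ≤ a₁) :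
    DatumGauge165TopStepCore F N Sup Mc ρ B₃ C θ Q a₀' a₁' :=
  fun ν M g K k s hsep hM₁ hk ε δ hδ hcomp hcomp' hε hεcomp hεcomp' W h7 U h17 h19 hfib hcrit =>
    h ν M g K k s hsep hM₁ hk ε δ (fun n hn => ⟨(hδ n hn).1, (hδ n hn).2.trans ha₁⟩) hcomp hcomp'
      (fun n hn => ⟨(hε n hn).1, (hε n hn).2.trans ha₀⟩) hεcomp hεcomp' W h7 U h17 h19 hfib hcrit

/-- The per-datum token is MONOTONE in the budget letters `C`, `θ`, `Q` (33b's clause is monotone in its threshold; `δ_j > 0`, `ε_j ≥ B₃δ_j ≥ 0` for `B₃ ≥ 0`).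
[cite: Balaban1985Variational, (165) p.304 (bookkeeping)] -/
theorem DatumGauge165TopStepCore.of_le_budget {Sup : (ν : Stage7Numerics) → (K : ℕ) → (ℕ → Set (Site (F.P K) 0)) → Set (Site (F.P K) 0)} {Mc ρ : ℕ}
    {B₃ C C' θ θ' Q Q' a₀ a₁ : ℝ} (h : DatumGauge165TopStepCore F N Sup Mc ρ B₃ C θ Q a₀ a₁) (hB₃ : 0 ≤ B₃) (hC : C ≤ C') (hθ : θ ≤ θ')
    (hQ : Q ≤ Q') : DatumGauge165TopStepCore F N Sup Mc ρ B₃ C' θ' Q' a₀ a₁ := by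
  intro ν M g K k s hsep hM₁ hk ε δ hδ hcomp hcomp' hε hεcomp hεcomp' W h7 U h17 h19 hfib hcrit j hj hjk a ha
  have hg := h ν M g K k s hsep hM₁ hk ε δ hδ hcomp hcomp' hε hεcomp hεcomp' W h7 U h17 h19 hfib hcrit j hj hjk a ha
  have hδ0 : 0 ≤ δ j := (hδ j hjk).1.le
  have hε0 : 0 ≤ ε j := (mul_nonneg hB₃ hδ0).trans (hε j hjk).1
  have ht : C * δ j + θ * ε j + Q * ε j ^ 2 ≤ C' * δ j + θ' * ε j + Q' * ε j ^ 2 :=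
    add_le_add (add_le_add (mul_le_mul_of_nonneg_right hC hδ0) (mul_le_mul_of_nonneg_right hθ hε0))
      (mul_le_mul_of_nonneg_right hQ (sq_nonneg _))
  exact hg.of_le ht

end Token

/-! ## §2  Plumbing: the grid cube of a lift; the `Within 3` witnesses of a plaquette MEETING a set and of a bond whose stencil meets it -/

section Plumbing

variable {P : Params}

/-- The lift of a point lies in the grid cube of its index (p592904 ∕ p594564 have it privately; public here for the R0′ split edition's reuse). [folklore] -/
theorem mem_cubeExt_cubeIdx {S : ℕ} (hS : 0 < S) (x : Pt P.d) : x ∈ cubeExt S (cubeIdx S x) 0 := fun i => by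
  simp only [sub_zero, add_zero]
  exact ⟨cubeIdx_le S hS x i, by have := lt_cubeIdx S hS x i; omega⟩

/-- A plaquette MEETING a site set has a corner `π(x + v)`, `x = lift p.src`, `v ∈ {0, e_μ, e_ν, e_μ + e_ν}`, in it — a witness within `1 ≤ 3` of `x` (adapted from p592904's
private `exists_within_one_of_mem_plaqsOf`; public here for reuse). [cite: Balaban1985RegularSpaces, p.77 (convention before (1.5)); Balaban1987RG1, (0.1) p.251 (bookkeeping)] -/
theorem exists_within_three_of_mem_plaqsOf {X : Set (Site P 0)} {p : Plaq P 0} (hp : p ∈ B8Eq17ClassAkV1.plaqsOf X) :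
    ∃ y : Pt P.d, cover P y ∈ X ∧ Within ((3 : ℕ) : ℤ) (lift P p.src) y := by
  set x := lift P p.src with hx
  have hsrc : p.src = cover P x := by rw [hx, cover_lift]
  have w0 : Within ((3 : ℕ) : ℤ) x x := Within.refl (by norm_num) x
  have w1 : ∀ μ : Fin P.d, Within ((3 : ℕ) : ℤ) x (x + e μ) := fun μ i => by
    simp only [Pi.add_apply, e_apply]; split_ifs <;> simp
  have w2 : ∀ μ ν : Fin P.d, Within ((3 : ℕ) : ℤ) x (x + e μ + e ν) := fun μ ν i => by
    simp only [Pi.add_apply, e_apply]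
    rw [abs_le]; split_ifs <;> constructor <;> push_cast <;> linarith
  rcases hp with h | h | h | h
  · exact ⟨x, by rwa [← hsrc], w0⟩
  · exact ⟨x + e p.μ, by rwa [cover_add_e, ← hsrc], w1 _⟩
  · exact ⟨x + e p.ν, by rwa [cover_add_e, ← hsrc], w1 _⟩
  · exact ⟨x + e p.μ + e p.ν, by rwa [cover_add_e, cover_add_e, ← hsrc], w2 _ _⟩

/-- A stencil point of a bond gives a witness within `3` of `lift b.src − 𝟙`: if `b ∉ Sect2.bondsDeep Xᶜ` then some `y` with `π y ∈ X` and `Within 3 (lift b.src − 𝟙) y` (the stencil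
`x, x + e_μ, x ± e_ν, x + e_μ ± e_ν` sits in `[x − 𝟙, x + 2·𝟙]`, `x = lift b.src`) (p594564's private `exists_within_three_of_not_mem_bondsDeep_compl`; public here for reuse).
[cite: Balaban1985RegularSpaces, (1.2) p.76 (bookkeeping); Balaban1987RG1, (0.1) p.251] -/
theorem exists_within_three_of_not_mem_bondsDeep_compl {X : Set (Site P 0)} {b : PBond P 0} (hb : b ∉ Sect2.bondsDeep Xᶜ) :
    ∃ y : Pt P.d, cover P y ∈ X ∧ Within ((3 : ℕ) : ℤ) (lift P b.src - fun _ => 1) y := by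
  set x := lift P b.src with hx
  have hsrc : b.src = cover P x := by rw [hx, cover_lift]
  have htgt : b.tgt = cover P (x + e b.dir) := by rw [PBond.tgt, hsrc, cover_add_e]
  -- a uniform bound: any `y` with `x i − 1 ≤ y i ≤ x i + 2` is within `3` of `x − 𝟙`
  have near : ∀ y : Pt P.d, (∀ i, x i - 1 ≤ y i ∧ y i ≤ x i + 2) → Within ((3 : ℕ) : ℤ) (x - fun _ => 1) y := fun y hy i => by
    simp only [Pi.sub_apply, Nat.cast_ofNat]
    rw [abs_le]; constructor <;> linarith [(hy i).1, (hy i).2]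
  have b0 : ∀ i : Fin P.d, x i - 1 ≤ x i ∧ x i ≤ x i + 2 := fun i => ⟨by linarith, by linarith⟩
  have bA : ∀ μ i : Fin P.d, x i - 1 ≤ (x + e μ) i ∧ (x + e μ) i ≤ x i + 2 := fun μ i => by
    simp only [Pi.add_apply, e_apply]; split_ifs <;> constructor <;> linarith
  have bS : ∀ μ i : Fin P.d, x i - 1 ≤ (x - e μ) i ∧ (x - e μ) i ≤ x i + 2 := fun μ i => by
    simp only [Pi.sub_apply, e_apply]; split_ifs <;> constructor <;> linarith
  have bAA : ∀ μ ν i : Fin P.d, x i - 1 ≤ (x + e μ + e ν) i ∧ (x + e μ + e ν) i ≤ x i + 2 := fun μ ν i => by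
    simp only [Pi.add_apply, e_apply]; split_ifs <;> constructor <;> linarith
  have bAS : ∀ μ ν i : Fin P.d, x i - 1 ≤ (x + e μ - e ν) i ∧ (x + e μ - e ν) i ≤ x i + 2 := fun μ ν i => by
    simp only [Pi.sub_apply, Pi.add_apply, e_apply]; split_ifs <;> constructor <;> linarith
  -- negate the «deep in the complement» clause
  simp only [Sect2.bondsDeep, Set.mem_setOf_eq, Set.mem_compl_iff, not_and_or, not_forall, not_not] at hb
  rcases hb with h | h | ⟨ν, h | h | h | h⟩
  · exact ⟨x, by rwa [← hsrc], near x b0⟩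
  · exact ⟨x + e b.dir, by rwa [← htgt], near _ (bA _)⟩
  · exact ⟨x + e ν, by rw [cover_add_e, ← hsrc]; exact h, near _ (bA _)⟩
  · exact ⟨x - e ν, by rw [cover_sub_e, ← hsrc]; exact h, near _ (bS _)⟩
  · exact ⟨x + e b.dir + e ν, by rw [cover_add_e, ← htgt]; exact h, near _ (bAA _ _)⟩
  · exact ⟨x + e b.dir - e ν, by rw [cover_sub_e, ← htgt]; exact h, near _ (bAS _ _)⟩

end Plumbing

/-! ## §3  ★★★ The reduction: the per-plaquette ∕ per-bond token from the per-datum one -/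

section Reduction

variable {F : T4Family} {N : ℕ} [NeZero N]

/-- ★★★ **«THE CUBE Δ₀ IS AN ARBITRARY CUBE Δ(y) = B^j(y), IF y ∈ Λ_j» — THE ∃-INTRODUCTION OF THE S6 HEAD, ONCE AND FOR ALL**: the per-datum token
`DatumGauge165TopStepCore F N Sup Mc ρ B₃ C θ Q a₀ a₁` (a (165)-shaped local gauge on the window `π(□)` of the print datum of EVERY level-`j` grid cube near `Ω_j`) gives the
per-plaquette ∕ per-bond token `LocalLetters165TopStepCore F N Sup B₃ C θ Q a₀ a₁` of p587134, for `Mc ≥ 1` and `ρ ≥ L`.  Per CORE plaquette `p` of the level-`m` top class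
(`p ∉ Sect2.printedPlaqs s.Ω k 0`): the level is `i := j` of p594564's `Sect2.exists_level_of_core_plaq` (`max m 1 ≤ j ≤ k`, `p ∈ plaqsOf (Ω j)`: a corner of `p` in `Ω_j`,
hence a site of `Ω_j` within `1 ≤ 3` of `x = lift p₋`), the cube is `a := cubeIdx (LʲMc) x ∋ x`, the window is `Y := π(box L (cornerP Mc ρ a) (sideP Mc ρ) j)` and
`p ∈ plaqInside Y` is p606159's `Sect2.mem_plaqInside_cover_box_propCubeP`; per CORE bond `b` (`b ∉ Sect2.bondsDeep (Ω 1)ᶜ`): level from `Sect2.exists_level_of_core_bond`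
(stencil meets `Ω_j`: a site of `Ω_j` within `3` of `lift b₋ − 𝟙`), cube `a := cubeIdx (LʲMc) (lift b₋ − 𝟙)`, `b ∈ Sect2.bondsDeep Y` by `Sect2.mem_bondsDeep_cover_box_propCubeP`.
The per-datum token is a HYPOTHESIS here (A6: LOCATED — antecedent = the token).
[cite: Balaban1985Variational, p.304 («The cube Δ₀ is an arbitrary cube …»), p.302 («a unit cube Δ₀ ⊂ B_j(Λ_j) containing p or b»), (165) p.304, (7) p.278; Balaban1985RegularSpaces, (1.7)–(1.9) p.77, (1.2) p.76; Balaban1988Convergent, (2.12)–(2.13) p.256, (2.17) p.257] -/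
theorem localLetters165Core_of_datumGauge165Core {Sup : (ν : Stage7Numerics) → (K : ℕ) → (ℕ → Set (Site (F.P K) 0)) → Set (Site (F.P K) 0)}
    {Mc ρ : ℕ} (hMc : 1 ≤ Mc) (hρ : F.L ≤ ρ) {B₃ C θ Q a₀ a₁ : ℝ} (h : DatumGauge165TopStepCore F N Sup Mc ρ B₃ C θ Q a₀ a₁) :
    LocalLetters165TopStepCore F N Sup B₃ C θ Q a₀ a₁ := by
  intro ν M g K k s hsep hM₁ hk ε δ hδ hcomp hcomp' hε hεcomp hεcomp' W h7 U h17 h19 hfib hcrit m hm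
  have hD := h ν M g K k s hsep hM₁ hk ε δ hδ hcomp hcomp' hε hεcomp hεcomp' W h7 U h17 h19 hfib hcrit
  have hρK : (F.P K).L ≤ ρ := hρ
  have hS : ∀ j, 0 < side (F.P K).L Mc j := fun j => B14.Eq213MaximalDomains.side_pos (F.P K).L_pos hMc j
  refine ⟨fun p hp hcore => ?_, fun b hb hcore => ?_⟩
  · obtain ⟨j, hmj, hjk, hpj⟩ := Sect2.exists_level_of_core_plaq hk hm hp hcore
    have hj : 1 ≤ j := le_trans (le_max_right m 1) hmj
    obtain ⟨y, hy, hxy⟩ := exists_within_three_of_mem_plaqsOf hpj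
    have hg := hD j hj hjk (cubeIdx (side (F.P K).L Mc j) (lift (F.P K) p.src))
      ⟨lift (F.P K) p.src, y, mem_cubeExt_cubeIdx (hS j) _, hy, hxy⟩
    exact ⟨_, j, le_trans (le_max_left m 1) hmj, hjk, Sect2.mem_plaqInside_cover_box_propCubeP p hj hMc hρK, hg⟩
  · obtain ⟨j, hmj, hjk, hbj⟩ := Sect2.exists_level_of_core_bond hk hm hb hcore
    have hj : 1 ≤ j := le_trans (le_max_right m 1) hmj
    obtain ⟨y, hy, hxy⟩ := exists_within_three_of_not_mem_bondsDeep_compl hbj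
    have hg := hD j hj hjk (cubeIdx (side (F.P K).L Mc j) (lift (F.P K) b.src - fun _ => 1))
      ⟨lift (F.P K) b.src - fun _ => 1, y, mem_cubeExt_cubeIdx (hS j) _, hy, hxy⟩
    exact ⟨_, j, le_trans (le_max_left m 1) hmj, hjk, Sect2.mem_bondsDeep_cover_box_propCubeP b hj hMc hρK, hg⟩

/-- ★★ **THE PER-DATUM (165)-GAUGES CLOSE THE ONE-STEP IMPROVEMENT ON THE CORE** (composition with p587134's `halvingStepTopCore_of_localLetters165Core`): the per-datum token
with `B₃ ≥ max{128C, 0}`, `θ ≤ 1∕512` (print's (163)), `Q ≥ 0` and `512·Q·a₀ ≤ 1` (print's (166) «ε₀ ≦ a₅»), at ceilings `a₀ ≤ ½`, for `Mc ≥ 1`, `ρ ≥ L`, gives k0-s1-w3's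
`HalvingStepTopCore F N Sup B₃ a₀ a₁` — hence (their `halvingStepTop_of_core`, n07-e's module 30, n21-c's socket ∕ `prop8StepCoP_of_localLetters165Core`) stub 1's body by
name.  The token is a HYPOTHESIS; this is an implication between named statements of the printed shape, not a discharge.
[cite: Balaban1985Variational, (165)–(168) p.304, (162)–(163) pp.303–304, Prop. 8 p.304; Balaban1985RegularSpaces, (1.7)–(1.9) p.77, (1.54) p.85] -/
theorem halvingStepTopCore_of_datumGauge165Core {Sup : (ν : Stage7Numerics) → (K : ℕ) → (ℕ → Set (Site (F.P K) 0)) → Set (Site (F.P K) 0)}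
    {Mc ρ : ℕ} (hMc : 1 ≤ Mc) (hρ : F.L ≤ ρ) {B₃ C θ Q a₀ a₁ : ℝ} (h : DatumGauge165TopStepCore F N Sup Mc ρ B₃ C θ Q a₀ a₁)
    (hB₃ : 0 ≤ B₃) (hC : 128 * C ≤ B₃) (hθ' : 512 * θ ≤ 1) (hQ : 0 ≤ Q) (ha : 512 * Q * a₀ ≤ 1) (ha₀ : 2 * a₀ ≤ 1) :
    HalvingStepTopCore F N Sup B₃ a₀ a₁ :=
  halvingStepTopCore_of_localLetters165Core (localLetters165Core_of_datumGauge165Core hMc hρ h) hB₃ hC hθ' hQ ha ha₀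

end Reduction

/-! ## §4  Door algebra: the letter predicate is subadditive (any number of (159)-summands at the window) -/

section DoorAlgebra

variable {P : Params} {N : ℕ}

/-- `∇^ξ` is additive. [cite: Balaban1987RG1, (1.12) p.262 (bookkeeping)] -/
private theorem grad_add' {i : ℕ} (ξ : ℝ) (μ : Fin P.d) (F₁ F₂ : Site P i → MatA N) (x : Site P i) :
    grad ξ μ (fun y => F₁ y + F₂ y) x = grad ξ μ F₁ x + grad ξ μ F₂ x := by
  simp only [grad, smul_sub, smul_add]
  abel

/-- `∇^ξ` is subtractive. [cite: Balaban1987RG1, (1.12) p.262 (bookkeeping)] -/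
private theorem grad_sub' {i : ℕ} (ξ : ℝ) (μ : Fin P.d) (F₁ F₂ : Site P i → MatA N) (x : Site P i) :
    grad ξ μ (fun y => F₁ y - F₂ y) x = grad ξ μ F₁ x - grad ξ μ F₂ x := by
  simp only [grad, smul_sub]
  abel

/-- `∂^ξ` is additive in the potential. [cite: Balaban1985RegularSpaces, (1.2) p.76 (bookkeeping)] -/
private theorem curlA_add' {i : ℕ} (ξ : ℝ) (A₁ A₂ : PBond P i → MatA N) (y : Site P i) (ν μ : Fin P.d) :
    Sect2.curlA ξ (fun b => A₁ b + A₂ b) y ν μ = Sect2.curlA ξ A₁ y ν μ + Sect2.curlA ξ A₂ y ν μ := by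
  simp only [Sect2.curlA, grad, smul_sub, smul_add]
  abel

/-- `∂^ξ` is subtractive in the potential. [cite: Balaban1985RegularSpaces, (1.2) p.76 (bookkeeping)] -/
private theorem curlA_sub' {i : ℕ} (ξ : ℝ) (A₁ A₂ : PBond P i → MatA N) (y : Site P i) (ν μ : Fin P.d) :
    Sect2.curlA ξ (fun b => A₁ b - A₂ b) y ν μ = Sect2.curlA ξ A₁ y ν μ - Sect2.curlA ξ A₂ y ν μ := by
  simp only [Sect2.curlA, grad, smul_sub]
  abel

/-- `∂^{ξ*}∂^ξ` is additive in the potential. [cite: Balaban1985RegularSpaces, (1.2) p.76 (bookkeeping)] -/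
private theorem codiffCurlA_add' {i : ℕ} (ξ : ℝ) (A₁ A₂ : PBond P i → MatA N) (x : Site P i) (μ : Fin P.d) :
    Sect2.codiffCurlA ξ (fun b => A₁ b + A₂ b) x μ = Sect2.codiffCurlA ξ A₁ x μ + Sect2.codiffCurlA ξ A₂ x μ := by
  simp only [Sect2.codiffCurlA, curlA_add', smul_sub, smul_add, Finset.sum_sub_distrib, Finset.sum_add_distrib]
  abel

/-- `∂^{ξ*}∂^ξ` is subtractive in the potential. [cite: Balaban1985RegularSpaces, (1.2) p.76 (bookkeeping)] -/
private theorem codiffCurlA_sub' {i : ℕ} (ξ : ℝ) (A₁ A₂ : PBond P i → MatA N) (x : Site P i) (μ : Fin P.d) :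
    Sect2.codiffCurlA ξ (fun b => A₁ b - A₂ b) x μ = Sect2.codiffCurlA ξ A₁ x μ - Sect2.codiffCurlA ξ A₂ x μ := by
  simp only [Sect2.codiffCurlA, curlA_sub', smul_sub, Finset.sum_sub_distrib]
  abel

/-- **THE LETTERS ARE SUBADDITIVE**: `Letters10On Y ξ t₁ A₁ → Letters10On Y ξ t₂ A₂ → Letters10On Y ξ (t₁ + t₂) (A₁ + A₂)` — the shape-agnostic form of p584895's
`letters10On_of_eq159`, for the assembly of ANY number of (159)-summands at the window (three under road R4; a fourth, pure-gauge, summand under road R0′'s row (r2)); the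
three letters are built from `∇^ξ` and finite sums, hence additive.
[cite: Balaban1985Variational, (159) p.303, (164)–(165) p.304; Balaban1985RegularSpaces, (1.2) p.76] -/
theorem Letters10On.add {Y : Set (Site P 0)} {ξ t₁ t₂ : ℝ} {A₁ A₂ : PBond P 0 → MatA N} (h₁ : Letters10On Y ξ t₁ A₁) (h₂ : Letters10On Y ξ t₂ A₂) :
    Letters10On Y ξ (t₁ + t₂) (fun b => A₁ b + A₂ b) := by
  refine ⟨fun b hb => ?_, fun q hq => ?_, fun b hb => ?_⟩
  · exact (norm_add_le _ _).trans_lt (add_lt_add (h₁.1 b hb) (h₂.1 b hb))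
  · have e : grad ξ q.2.1 (fun y => A₁ ⟨y, q.2.2⟩ + A₂ ⟨y, q.2.2⟩) q.1 =
        grad ξ q.2.1 (fun y => A₁ ⟨y, q.2.2⟩) q.1 + grad ξ q.2.1 (fun y => A₂ ⟨y, q.2.2⟩) q.1 := grad_add' ξ q.2.1 _ _ q.1
    rw [e]
    exact (norm_add_le _ _).trans_lt (add_lt_add (h₁.2.1 q hq) (h₂.2.1 q hq))
  · rw [codiffCurlA_add']
    exact (norm_add_le _ _).trans_lt (add_lt_add (h₁.2.2 b hb) (h₂.2.2 b hb))

/-- **THE LETTERS ARE SUBADDITIVE UNDER DIFFERENCES**: `Letters10On Y ξ t₁ A₁ → Letters10On Y ξ t₂ A₂ → Letters10On Y ξ (t₁ + t₂) (A₁ − A₂)`.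
[cite: Balaban1985Variational, (159) p.303, (165) p.304; Balaban1985RegularSpaces, (1.2) p.76] -/
theorem Letters10On.sub {Y : Set (Site P 0)} {ξ t₁ t₂ : ℝ} {A₁ A₂ : PBond P 0 → MatA N} (h₁ : Letters10On Y ξ t₁ A₁) (h₂ : Letters10On Y ξ t₂ A₂) :
    Letters10On Y ξ (t₁ + t₂) (fun b => A₁ b - A₂ b) := by
  refine ⟨fun b hb => ?_, fun q hq => ?_, fun b hb => ?_⟩
  · exact (norm_sub_le _ _).trans_lt (add_lt_add (h₁.1 b hb) (h₂.1 b hb))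
  · have e : grad ξ q.2.1 (fun y => A₁ ⟨y, q.2.2⟩ - A₂ ⟨y, q.2.2⟩) q.1 =
        grad ξ q.2.1 (fun y => A₁ ⟨y, q.2.2⟩) q.1 - grad ξ q.2.1 (fun y => A₂ ⟨y, q.2.2⟩) q.1 := grad_sub' ξ q.2.1 _ _ q.1
    rw [e]
    exact (norm_sub_le _ _).trans_lt (add_lt_add (h₁.2.1 q hq) (h₂.2.1 q hq))
  · rw [codiffCurlA_sub']
    exact (norm_sub_le _ _).trans_lt (add_lt_add (h₁.2.2 b hb) (h₂.2.2 b hb))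

end DoorAlgebra

end Summit.QuantumFields.YangMills.BalabanUVNodes.N07LocalLettersCoreOfDatumGauges

end
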